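import Summits.SmoothPoincare4.SmoothPoincare4.Theorems.CylinderEntropyCylinderRungTwoGoodTimes
import HarnessLib

/-!
# Route `CylinderEntropy`, crux `CylinderRungTwo` (stmt-SmoothPoincare4-7631), line `killing-flux`:
# the heights of a thin immortal cylinder flow converge uniformly, given uniqueness of limit heights
# (registered helper `helper_heightsConvergeOfUnique`, lead c4, wave 3b, A4)

Along a smooth mean curvature flow `IsCylinderMCF M F ν T`
(`CylinderEntropyCylinderRungTwoKillingFluxDefs.lean`) of closed embedded cross-sections of
`N = S⁴ × ℝ ⊂ ℝ⁶` write `E(r) = ∫⁻_M ‖∂_r F(r, x)‖² d((F r)^* μH⁴)(x)` for the slice energy and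
`W(s) = ∫⁻_{[s, s+1]} E` for the dissipation over a unit window.

* `exists_goodTimeSeq` — from the landed GOOD TIMES (`helper_goodTimes`: `W(s) → 0` and every unit
  window `[s, s+1]`, `s ≥ T`, contains a time `r` with `E(r) ≤ W(s)`) one extracts a MONOTONE sequence
  of good times `t k ∈ [T + k + 2, T + k + 3]` with `E(t k) → 0` and `∫⁻_{[t k - 1, t k]} E → 0`
  (the backward unit window is covered by the two windows `[T+k+1, T+k+2] ∪ [T+k+2, T+k+3]`).
* `helper_heightsConvergeOfUnique` — the registered stub, CONDITIONAL on the neighbouring stub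
  `helper_limitHeightUnique` (taken verbatim as the hypothesis `Unique`): if along every monotone
  sequence of good times two point sequences cannot have different limit heights, then the heights
  `(F s x)₅` converge, uniformly in `x ∈ M`, to one value `c` as `s → ∞`.  ENVELOPE ARGUMENT: by the
  landed monotone height envelope (`helper_heightEnvelopeMonotone`: for `T ≤ s ≤ s'` every height of
  `M_{s'}` lies between two heights of `M_s`) the maximal height `hi k = max_x (F (t k) x)₅` (attained
  on the compact slice, extreme value theorem) is antitone in `k` and the minimal height `lo k` is
  monotone, and `lo 0 ≤ lo k ≤ hi k ≤ hi 0`; so both converge (monotone convergence), their limits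
  agree by `Unique` applied to the maximisers and minimisers, `=: c`, and for `s ≥ t k` every height of
  `M_s` is squeezed into `[lo k, hi k] ⊆ (c - ε, c + ε)`.  The empty cross-section is trivial.

Everything here is PROVED (no `sorry`, no definitions, no named facts).

References: K. Brakke, *The motion of a surface by its mean curvature* (1978), §3 (good times of the
dissipation); P. Topping, *Lectures on the Ricci flow* (2006), Thm. 3.1.1 (the scalar maximum
principle behind the monotone height envelope).
-/

-- the prescribed namespace `Summit.SmoothPoincare4.SmoothPoincare4.…` repeats `SmoothPoincare4`
set_option linter.dupNamespace false

noncomputable section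

open Bundle Set Function Filter MeasureTheory Module
open scoped Manifold ContDiff Topology RealInnerProductSpace BigOperators ENNReal NNReal

namespace Summit.SmoothPoincare4.SmoothPoincare4.Cruxes.CylinderRungTwo.KillingFlux

open Literature.Geometry.Riemannian Literature.Geometry.Riemannian.EuclideanHypersurface
open Literature.Geometry.Lorentzian Literature.Geometry.Lorentzian.PseudoRiemannianMetric
open Literature.Geometry.Riemannian.SphericalCylinderEntropy (cylKernel cylDensity cylEntropy truncL)

/-! ## A monotone sequence of good times -/

/-- **A monotone sequence of good times.** If the unit-window dissipation
`W(s) = ∫⁻_{[s, s+1]} E` of a density `E : ℝ → ℝ≥0∞` tends to `0` as `s → ∞` and every unit window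
`[s, s + 1]`, `s ≥ T`, contains a good time `r` (`E(r) ≤ W(s)`), then there is a monotone sequence
`t k ≥ T + 1` of good times (`t k ∈ [T + k + 2, T + k + 3]`) with `E(t k) → 0` and with backward
unit-window dissipation `∫⁻_{[t k - 1, t k]} E ≤ W(T + k + 1) + W(T + k + 2) → 0`. [folklore] -/
theorem exists_goodTimeSeq {E : ℝ → ℝ≥0∞} {T : ℝ}
    (hW : Tendsto (fun s : ℝ => ∫⁻ r in Icc s (s + 1), E r) atTop (𝓝 0))
    (hgood : ∀ s : ℝ, T ≤ s → ∃ r ∈ Icc s (s + 1), E r ≤ ∫⁻ r' in Icc s (s + 1), E r') :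
    ∃ t : ℕ → ℝ, Monotone t ∧ (∀ k, T + 1 ≤ t k) ∧
      Tendsto (fun k => ∫⁻ r in Icc (t k - 1) (t k), E r) atTop (𝓝 0) ∧
      Tendsto (fun k => E (t k)) atTop (𝓝 0) := by
  -- the windows `[a k, a k + 1]` and `[a k + 1, a k + 1 + 1]`, `a k = T + k + 1`
  have ha : ∀ k : ℕ, T ≤ T + k + 1 + 1 := fun k => by
    have hk : (0 : ℝ) ≤ k := Nat.cast_nonneg k
    linarith
  choose t ht hEt using fun k : ℕ => hgood (T + k + 1 + 1) (ha k)
  have htend : Tendsto (fun k : ℕ => T + (k : ℝ) + 1) atTop atTop :=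
    tendsto_atTop_add_const_right _ _
      (tendsto_atTop_add_const_left _ _ tendsto_natCast_atTop_atTop)
  have htend' : Tendsto (fun k : ℕ => T + (k : ℝ) + 1 + 1) atTop atTop :=
    tendsto_atTop_add_const_right _ _ htend
  refine ⟨t, ?_, ?_, ?_, ?_⟩
  · -- monotone: `t k ≤ a k + 2 = a (k + 1) + 1 ≤ t (k + 1)`
    refine monotone_nat_of_le_succ fun k => ?_
    have h1 := (ht k).2
    have h2 := (ht (k + 1)).1
    push_cast at h2
    linarith
  · intro k
    have h1 := (ht k).1
    have hk : (0 : ℝ) ≤ k := Nat.cast_nonneg k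
    linarith
  · -- the backward window `[t k - 1, t k] ⊆ [a k, a k + 1] ∪ [a k + 1, a k + 1 + 1]`
    have hsum : Tendsto (fun k : ℕ => (∫⁻ r in Icc (T + k + 1) (T + k + 1 + 1), E r) +
        ∫⁻ r in Icc (T + k + 1 + 1) (T + k + 1 + 1 + 1), E r) atTop (𝓝 0) := by
      rw [← add_zero (0 : ℝ≥0∞)]
      exact (hW.comp htend).add (hW.comp htend')
    refine tendsto_of_tendsto_of_tendsto_of_le_of_le tendsto_const_nhds hsum (fun k => zero_le)
      fun k => ?_
    calc ∫⁻ r in Icc (t k - 1) (t k), E r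
        ≤ ∫⁻ r in Icc (T + k + 1) (T + k + 1 + 1) ∪ Icc (T + k + 1 + 1) (T + k + 1 + 1 + 1), E r := by
          refine lintegral_mono_set ?_
          rw [Icc_union_Icc_eq_Icc (by linarith) (by linarith)]
          exact Icc_subset_Icc (by linarith [(ht k).1]) (ht k).2
      _ ≤ _ := lintegral_union_le _ _ _
  · -- the good times themselves: `E (t k) ≤ W (a k + 1) → 0`
    exact tendsto_of_tendsto_of_tendsto_of_le_of_le tendsto_const_nhds (hW.comp htend')
      (fun k => zero_le) hEt

/-! ## The registered helper -/

/-- **Registered helper `helper_heightsConvergeOfUnique` (A4): the heights of a thin immortal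
cylinder flow converge uniformly to one value, conditional on the uniqueness of limit heights along
good times (A4a, `helper_limitHeightUnique`, taken here as the hypothesis).**  Along a smooth mean
curvature flow `IsCylinderMCF M F ν T` of closed embedded cross-sections of `N = S⁴ × ℝ` with
`λ_cyl(M_t) < 2`: if for every monotone sequence `t k ≥ T + 1` of times with vanishing backward
unit-window dissipation and vanishing slice energy any two point sequences `x k, x' k ∈ M` whose
heights `(F (t k) (x k))₅`, `(F (t k) (x' k))₅` converge have the same limit, then there is `c ∈ ℝ`
with `sup_x |(F s x)₅ - c| → 0` as `s → ∞`.  Proof: good times (`exists_goodTimeSeq` on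
`helper_goodTimes`), the monotone height envelope (`helper_heightEnvelopeMonotone`) making the maximal
height antitone and the minimal height monotone along `t k` (extreme value theorem on the compact
slices), monotone convergence of both, the hypothesis on maximisers/minimisers identifying the two
limits, and the envelope once more to squeeze all later heights. [folklore] -/
theorem helper_heightsConvergeOfUnique : (∀ (M : Type) [TopologicalSpace M] [T2Space M] [SecondCountableTopology M] [ChartedSpace (EuclideanSpace ℝ (Fin 4)) M] [IsManifold (𝓡 4) ∞ M] [CompactSpace M] [MeasurableSpace M] [BorelSpace M] (F : ℝ → M → EuclideanSpace ℝ (Fin 6)) (ν : ℝ → M → EuclideanSpace ℝ (Fin 6)) (T : ℝ), IsCylinderMCF M F ν T → (∀ t, T ≤ t → Literature.Geometry.Riemannian.SphericalCylinderEntropy.cylEntropy (Set.range (F t)) < 2) → ∀ (t : ℕ → ℝ), Monotone t → (∀ k, T + 1 ≤ t k) → Filter.Tendsto (fun k => ∫⁻ r in Set.Icc (t k - 1) (t k), ∫⁻ x, ENNReal.ofReal (‖deriv (fun s => F s x) r‖ ^ 2) ∂(Measure.comap (F r) (μH[4] : Measure (EuclideanSpace ℝ (Fin 6))))) Filter.atTop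 (𝓝 0) → Filter.Tendsto (fun k => ∫⁻ x, ENNReal.ofReal (‖deriv (fun s => F s x) (t k)‖ ^ 2) ∂(Measure.comap (F (t k)) (μH[4] : Measure (EuclideanSpace ℝ (Fin 6))))) Filter.atTop (𝓝 0) → ∀ (x x' : ℕ → M) (c c' : ℝ), Filter.Tendsto (fun k => F (t k) (x k) 5) Filter.atTop (𝓝 c) → Filter.Tendsto (fun k => F (t k) (x' k) 5) Filter.atTop (𝓝 c') → c = c') → ∀ (M : Type) [TopologicalSpace M] [T2Space M] [SecondCountableTopology M] [ChartedSpace (EuclideanSpace ℝ (Fin 4)) M] [IsManifold (𝓡 4) ∞ M] [CompactSpace M] [MeasurableSpace M] [BorelSpace M] (F : ℝ → M → EuclideanSpace ℝ (Fin 6)) (ν : ℝ → M → EuclideanSpace ℝ (Fin 6)) (T : ℝ), IsCylinderMCF M F ν T → (∀ t, T ≤ t → Literature.Geometry.Riemannian.SphericalCylinderEntropy.cylEntropy (Set.range (F t)) < 2) → ∃ c : ℝ, ∀ ε : ℝ, 0 < ε → ∃ s₀ : ℝ, T ≤ s₀ ∧ ∀ s, s₀ ≤ s → ∀ x : M, |F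 s x 5 - c| < ε := by
  intro hU M _ _ _ _ _ _ _ _ F ν T hF hent
  rcases isEmpty_or_nonempty M with hM | hM
  · -- the empty cross-section: nothing to prove
    exact ⟨0, fun ε _ => ⟨T, le_rfl, fun s _ x => isEmptyElim x⟩⟩
  -- (1) a monotone sequence of good times `t k ≥ T + 1`
  obtain ⟨hW0, hgood⟩ := helper_goodTimes M F ν T hF
  obtain ⟨t, ht_mono, ht_ge, hwin, hslice⟩ := exists_goodTimeSeq hW0 hgood
  have htT : ∀ k, T ≤ t k := fun k => by linarith [ht_ge k]
  -- (2) the height attains its maximum and minimum on each compact slice `M_{t k}`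
  have hcont : ∀ s, T ≤ s → Continuous fun x : M => F s x 5 := fun s hs =>
    (PiLp.continuous_apply 2 _ (5 : Fin 6)).comp
      (hF.isSmoothEmbedding s hs).isEmbedding.continuous
  have hmax : ∀ k : ℕ, ∃ x : M, ∀ y : M, F (t k) y 5 ≤ F (t k) x 5 := fun k => by
    obtain ⟨x, -, hx⟩ :=
      isCompact_univ.exists_isMaxOn univ_nonempty (hcont _ (htT k)).continuousOn
    exact ⟨x, fun y => hx (mem_univ y)⟩
  have hmin : ∀ k : ℕ, ∃ x : M, ∀ y : M, F (t k) x 5 ≤ F (t k) y 5 := fun k => by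
    obtain ⟨x, -, hx⟩ :=
      isCompact_univ.exists_isMinOn univ_nonempty (hcont _ (htT k)).continuousOn
    exact ⟨x, fun y => hx (mem_univ y)⟩
  choose xhi hxhi using hmax
  choose xlo hxlo using hmin
  -- (3) the envelope: the maximal height is antitone, the minimal height monotone along `t k`
  have henv := helper_heightEnvelopeMonotone M F ν T hF
  have hanti : Antitone fun k => F (t k) (xhi k) 5 := by
    intro k k' hkk'
    obtain ⟨y, y', -, hy'⟩ := henv (t k) (t k') (htT k) (ht_mono hkk') (xhi k')
    exact hy'.trans (hxhi k y')
  have hmono : Monotone fun k => F (t k) (xlo k) 5 := by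
    intro k k' hkk'
    obtain ⟨y, y', hy, -⟩ := henv (t k) (t k') (htT k) (ht_mono hkk') (xlo k')
    exact (hxlo k y).trans hy
  have hlohi : ∀ k, F (t k) (xlo k) 5 ≤ F (t k) (xhi k) 5 := fun k => hxlo k (xhi k)
  have hbelow : BddBelow (range fun k => F (t k) (xhi k) 5) := by
    refine ⟨F (t 0) (xlo 0) 5, ?_⟩
    rintro _ ⟨k, rfl⟩
    exact (hmono (Nat.zero_le k)).trans (hlohi k)
  have habove : BddAbove (range fun k => F (t k) (xlo k) 5) := by
    refine ⟨F (t 0) (xhi 0) 5, ?_⟩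
    rintro _ ⟨k, rfl⟩
    exact (hlohi k).trans (hanti (Nat.zero_le k))
  obtain ⟨c, hhi⟩ : ∃ c, Tendsto (fun k => F (t k) (xhi k) 5) atTop (𝓝 c) :=
    ⟨_, tendsto_atTop_ciInf hanti hbelow⟩
  obtain ⟨c', hlo⟩ : ∃ c', Tendsto (fun k => F (t k) (xlo k) 5) atTop (𝓝 c') :=
    ⟨_, tendsto_atTop_ciSup hmono habove⟩
  -- (4) the two limit heights agree, by the hypothesis `Unique` on maximisers and minimisers
  obtain rfl : c = c' := hU M F ν T hF hent t ht_mono ht_ge hwin hslice xhi xlo c c' hhi hlo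
  -- (5) squeeze: for `s ≥ t k` every height of `M_s` lies in `[lo k, hi k] ⊆ (c - ε, c + ε)`
  refine ⟨c, fun ε hε => ?_⟩
  obtain ⟨k, hk1, hk2⟩ := ((hhi.eventually_lt_const (show c < c + ε by linarith)).and
    (hlo.eventually_const_lt (show c - ε < c by linarith))).exists
  refine ⟨t k, htT k, fun s hs x => ?_⟩
  obtain ⟨y, y', hy, hy'⟩ := henv (t k) s (htT k) hs x
  have h1 := hxhi k y'
  have h2 := hxlo k y
  rw [abs_sub_lt_iff]
  constructor <;> linarith

end Summit.SmoothPoincare4.SmoothPoincare4.Cruxes.CylinderRungTwo.KillingFlux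

end
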